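import Summits.RiemannHypothesis.RiemannHypothesis.Theorems.SoloInformedGroundStateEMap
import Literature.NumberTheory.Automorphic.MeyerRatDivisibilityAvg

/-!
# Ground-state endgame, VI: at a zero the window transform is minus the leak

Solo programme `solo-RiemannHypothesis-informed`, session 1 — part of the assembled endgame of
the semilocal (Weil ground state) programme (Connes 2026, arXiv:2602.04022, §6.6); overview in
`SoloInformedGroundStateLimit.lean`. Everything here is proved; the only named fact used anywhere
in the package is `Connes2026_weilGroundState_zeros_re_eq_half` (C–vS Thm. 6.1), as a hypothesis.

`mellin_window_eq_neg_leak_of_riemannZeta_eq_zero` and the quantitative form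
`norm_mellin_window_le_of_riemannZeta_eq_zero`: at a zero of `Φ = λ^s ζ(s) Mh(s)` the Mellin
transform of the dilated window sum IS minus the leak transform, bounded explicitly.
-/

noncomputable section

open Complex Filter Set Topology Metric MeasureTheory
open Literature.NumberTheory.LFunctions

namespace Summit.RiemannHypothesis.RiemannHypothesis.Theorems

section EMap

open Asymptotics

/-- At a non-trivial zero: the window transform equals minus the leak transform. -/
theorem mellin_indicator_Ioi_eq_neg_leak_of_zero {S : ℝ → ℂ} {u₀ u₁ C : ℝ} (hu₀ : 0 < u₀)
    (hSm : AEStronglyMeasurable S volume) (hSb : ∀ u, 0 < u → ‖S u‖ ≤ C) (hS0 : ∀ u, u₁ ≤ u → S u = 0)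
    {Φ : ℂ → ℂ} (hΦ : DifferentiableOn ℂ Φ {s : ℂ | 0 < s.re ∧ s ≠ 1})
    (heq : ∀ s : ℂ, 1 < s.re → mellin S s = Φ s)
    {ρ : ℂ} (hρ : 0 < ρ.re) (hρ1 : ρ ≠ 1) (hΦρ : Φ ρ = 0) :
    mellin ((Ioi u₀).indicator S) ρ = -mellin ((Ioc 0 u₀).indicator S) ρ := by
  rw [mellin_indicator_Ioi_eq_of_eqOn hu₀ hSm hSb hS0 hΦ heq hρ hρ1, hΦρ, zero_sub]

/-- The main term `Φ(s) = λ^s ζ(s) · mellin h s` is holomorphic on the punctured half-plane. -/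
theorem differentiableOn_mainTerm (h : SchwartzMap ℝ ℂ) {lam : ℝ} (hlam : 0 < lam) :
    DifferentiableOn ℂ (fun s : ℂ => (lam : ℂ) ^ s * riemannZeta s * mellin (fun x : ℝ => h x) s)
      {s : ℂ | 0 < s.re ∧ s ≠ 1} := by
  intro s hs
  have hlam' : (lam : ℂ) ≠ 0 := by exact_mod_cast hlam.ne'
  have h1 : DifferentiableAt ℂ (fun s : ℂ => (lam : ℂ) ^ s) s :=
    differentiableAt_id.const_cpow (Or.inl hlam')
  have h2 : DifferentiableAt ℂ riemannZeta s := differentiableAt_riemannZeta hs.2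
  have h3 := Literature.NumberTheory.Automorphic.Meyer.differentiableAt_mellin_schwartz h hs.1
  exact ((h1.mul h2).mul h3).differentiableWithinAt

/-- **(★) at the zeros, concrete main term.** For a Schwartz seed `h`, a dilation `λ > 0` and the E-map
sum `S(u) = ∑_{n ≥ 1} h(n u/λ)` — assumed bounded, measurable and vanishing beyond `u₁` (true for `h` of
compact support; discharged in the sequel) — the Mellin transform of the WINDOW part `1_{(u₀,∞)} S` at any
`ρ` with `0 < Re ρ`, `ρ ≠ 1`, `ζ(ρ) = 0` equals minus that of the LEAK part `1_{(0,u₀]} S`. -/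
theorem mellin_window_eq_neg_leak_of_riemannZeta_eq_zero (h : SchwartzMap ℝ ℂ) {lam u₀ u₁ C : ℝ}
    (hlam : 0 < lam) (hu₀ : 0 < u₀)
    (hSm : AEStronglyMeasurable (fun u : ℝ => ∑' n : ℕ, h (((n + 1 : ℕ) : ℝ) * (lam⁻¹ * u))) volume)
    (hSb : ∀ u : ℝ, 0 < u → ‖∑' n : ℕ, h (((n + 1 : ℕ) : ℝ) * (lam⁻¹ * u))‖ ≤ C)
    (hS0 : ∀ u : ℝ, u₁ ≤ u → (∑' n : ℕ, h (((n + 1 : ℕ) : ℝ) * (lam⁻¹ * u))) = 0)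
    {ρ : ℂ} (hρ : 0 < ρ.re) (hρ1 : ρ ≠ 1) (hζ : riemannZeta ρ = 0) :
    mellin ((Ioi u₀).indicator fun u : ℝ => ∑' n : ℕ, h (((n + 1 : ℕ) : ℝ) * (lam⁻¹ * u))) ρ =
      -mellin ((Ioc 0 u₀).indicator fun u : ℝ => ∑' n : ℕ, h (((n + 1 : ℕ) : ℝ) * (lam⁻¹ * u))) ρ :=
  mellin_indicator_Ioi_eq_neg_leak_of_zero hu₀ hSm hSb hS0 (differentiableOn_mainTerm h hlam)
    (fun s hs => mellin_dilatedSum_eq h hlam hs) hρ hρ1 (by simp [hζ])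

/-- The E-map sum of a seed supported in `(-∞, 1]` vanishes beyond the window: for `u > λ` every term
`h((n+1)u/λ)` has argument `> 1`. (Discharges the hypothesis `hS0` of
`mellin_window_eq_neg_leak_of_riemannZeta_eq_zero` with `u₁ = λ + 1`.) -/
theorem dilatedSum_eq_zero_of_lt (h : SchwartzMap ℝ ℂ) (hsupp : ∀ x : ℝ, 1 < x → h x = 0)
    {lam : ℝ} (hlam : 0 < lam) {u : ℝ} (hu : lam < u) :
    (∑' n : ℕ, h (((n + 1 : ℕ) : ℝ) * (lam⁻¹ * u))) = 0 := by
  have hterm : ∀ n : ℕ, h (((n + 1 : ℕ) : ℝ) * (lam⁻¹ * u)) = 0 := fun n => by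
    apply hsupp
    have h1 : 1 < lam⁻¹ * u := by
      rw [inv_mul_eq_div, one_lt_div hlam]; exact hu
    have h2 : (1 : ℝ) ≤ ((n + 1 : ℕ) : ℝ) := by exact_mod_cast Nat.succ_le_succ (Nat.zero_le n)
    calc (1 : ℝ) < lam⁻¹ * u := h1
      _ = 1 * (lam⁻¹ * u) := (one_mul _).symm
      _ ≤ ((n + 1 : ℕ) : ℝ) * (lam⁻¹ * u) := mul_le_mul_of_nonneg_right h2 (by positivity)
  have hfun : (fun n : ℕ => h (((n + 1 : ℕ) : ℝ) * (lam⁻¹ * u))) = fun _ => 0 := funext hterm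
  rw [hfun, tsum_zero]

/-- `dilatedSum_eq_zero_of_le` (auxiliary; see the module docstring). -/
theorem dilatedSum_eq_zero_of_le (h : SchwartzMap ℝ ℂ) (hsupp : ∀ x : ℝ, 1 < x → h x = 0)
    {lam : ℝ} (hlam : 0 < lam) (u : ℝ) (hu : lam + 1 ≤ u) :
    (∑' n : ℕ, h (((n + 1 : ℕ) : ℝ) * (lam⁻¹ * u))) = 0 :=
  dilatedSum_eq_zero_of_lt h hsupp hlam (by linarith)

/-- Schwartz decay in the form used below: `‖h x‖ ≤ C / x²` for `x > 0`, `C` the `(2,0)` seminorm. -/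
theorem norm_schwartz_le_div_sq (h : SchwartzMap ℝ ℂ) {x : ℝ} (hx : 0 < x) :
    ‖h x‖ ≤ SchwartzMap.seminorm ℝ 2 0 h / x ^ 2 := by
  have key := SchwartzMap.le_seminorm ℝ 2 0 h x
  rw [norm_iteratedFDeriv_zero, Real.norm_eq_abs, abs_of_pos hx] at key
  rw [le_div_iff₀ (by positivity)]
  linarith [mul_comm (x ^ 2) ‖h x‖]

/-- The dilated E-map sum `u ↦ ∑_{n ≥ 1} h(n u/λ)` is continuous on every `(a, ∞)`, `a > 0`
(uniform convergence from the Schwartz bound `‖h x‖ ≤ C/x²`). -/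
theorem continuousOn_dilatedSum_Ioi (h : SchwartzMap ℝ ℂ) {lam a : ℝ} (hlam : 0 < lam) (ha : 0 < a) :
    ContinuousOn (fun u : ℝ => ∑' n : ℕ, h (((n + 1 : ℕ) : ℝ) * (lam⁻¹ * u))) (Ioi a) := by
  set C := SchwartzMap.seminorm ℝ 2 0 h with hC
  have hC0 : 0 ≤ C := by positivity
  refine continuousOn_tsum (u := fun n : ℕ => C * (lam / a) ^ 2 * (1 / ((n + 1 : ℕ) : ℝ) ^ 2))
    (fun n => ?_) ?_ ?_
  · exact (h.continuous.comp (continuous_const.mul (continuous_const.mul continuous_id))).continuousOn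
  · have hs : Summable fun n : ℕ => 1 / ((n + 1 : ℕ) : ℝ) ^ 2 :=
      (summable_nat_add_iff (f := fun n : ℕ => 1 / (n : ℝ) ^ 2) 1).mpr
        (Real.summable_one_div_nat_pow.mpr one_lt_two)
    exact hs.mul_left _
  · intro n u hu
    have hu0 : a < u := hu
    have hx0 : 0 < ((n + 1 : ℕ) : ℝ) * (a / lam) := by positivity
    have hx : ((n + 1 : ℕ) : ℝ) * (a / lam) ≤ ((n + 1 : ℕ) : ℝ) * (lam⁻¹ * u) := by
      apply mul_le_mul_of_nonneg_left _ (by positivity)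
      rw [inv_mul_eq_div]
      exact div_le_div_of_nonneg_right hu0.le hlam.le
    have hxpos : 0 < ((n + 1 : ℕ) : ℝ) * (lam⁻¹ * u) := hx0.trans_le hx
    calc ‖h (((n + 1 : ℕ) : ℝ) * (lam⁻¹ * u))‖
        ≤ C / (((n + 1 : ℕ) : ℝ) * (lam⁻¹ * u)) ^ 2 := norm_schwartz_le_div_sq h hxpos
      _ ≤ C / (((n + 1 : ℕ) : ℝ) * (a / lam)) ^ 2 := by
          apply div_le_div_of_nonneg_left hC0 (by positivity)
          exact pow_le_pow_left₀ hx0.le hx 2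
      _ = C * (lam / a) ^ 2 * (1 / ((n + 1 : ℕ) : ℝ) ^ 2) := by
          field_simp

/-- Hence it is continuous on `(0, ∞)` and a.e.-strongly measurable after extension by zero. -/
theorem continuousOn_dilatedSum (h : SchwartzMap ℝ ℂ) {lam : ℝ} (hlam : 0 < lam) :
    ContinuousOn (fun u : ℝ => ∑' n : ℕ, h (((n + 1 : ℕ) : ℝ) * (lam⁻¹ * u))) (Ioi 0) := by
  intro u hu
  have hu2 : (0 : ℝ) < u / 2 := half_pos (mem_Ioi.mp hu)
  have hmem : u ∈ Ioi (u / 2) := by simp only [mem_Ioi]; linarith [mem_Ioi.mp hu]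
  exact ((continuousOn_dilatedSum_Ioi h hlam hu2).continuousAt (Ioi_mem_nhds hmem)).continuousWithinAt

/-- `aestronglyMeasurable_indicator_dilatedSum` (auxiliary; see the module docstring). -/
theorem aestronglyMeasurable_indicator_dilatedSum (h : SchwartzMap ℝ ℂ) {lam : ℝ} (hlam : 0 < lam) :
    MeasureTheory.AEStronglyMeasurable
      ((Ioi (0 : ℝ)).indicator fun u : ℝ => ∑' n : ℕ, h (((n + 1 : ℕ) : ℝ) * (lam⁻¹ * u)))
      MeasureTheory.volume :=
  (aestronglyMeasurable_indicator_iff measurableSet_Ioi).mpr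
    ((continuousOn_dilatedSum h hlam).aestronglyMeasurable measurableSet_Ioi)

/-- SIZE OF THE LEAK TRANSFORM: if `‖S‖ ≤ M` on `(0, u₀]` then
`‖mellin ((Ioc 0 u₀).indicator S) s‖ ≤ M u₀^{Re s} / Re s` for `0 < Re s`. Combined with
`mellin_window_eq_neg_leak_of_riemannZeta_eq_zero`, the window transform at a zeta zero is as small as
the E-map sum is below the window. -/
theorem norm_mellin_indicator_Ioc_le {S : ℝ → ℂ} {u₀ M : ℝ} (hu₀ : 0 < u₀)
    (hSb : ∀ u, 0 < u → u ≤ u₀ → ‖S u‖ ≤ M) {s : ℂ} (hs : 0 < s.re) :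
    ‖mellin ((Ioc 0 u₀).indicator S) s‖ ≤ M * u₀ ^ s.re / s.re := by
  have hM : 0 ≤ M := le_trans (norm_nonneg _) (hSb u₀ hu₀ le_rfl)
  -- move the indicator outside and restrict the domain of integration
  have h1 : mellin ((Ioc 0 u₀).indicator S) s
      = ∫ t : ℝ in Ioc 0 u₀, (t : ℂ) ^ (s - 1) • S t := by
    unfold mellin
    have : (fun t : ℝ => (t : ℂ) ^ (s - 1) • (Ioc 0 u₀).indicator S t)
        = (Ioc 0 u₀).indicator (fun t : ℝ => (t : ℂ) ^ (s - 1) • S t) := by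
      funext t; exact (indicator_smul_apply (Ioc 0 u₀) (fun t : ℝ => (t : ℂ) ^ (s - 1)) S t).symm
    rw [this, setIntegral_indicator measurableSet_Ioc,
      inter_eq_right.mpr Ioc_subset_Ioi_self]
  rw [h1]
  -- pointwise bound on (0, u₀]
  have hbound : ∀ᵐ (t : ℝ) ∂(volume.restrict (Ioc (0 : ℝ) u₀)),
      ‖((t : ℝ) : ℂ) ^ (s - 1) • S t‖ ≤ M * t ^ (s.re - 1) := by
    refine (ae_restrict_mem measurableSet_Ioc).mono fun t ht => ?_
    rw [norm_smul, norm_cpow_eq_rpow_re_of_pos ht.1, sub_re, one_re, mul_comm]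
    exact mul_le_mul_of_nonneg_right (hSb t ht.1 ht.2) (Real.rpow_nonneg ht.1.le _)
  have hint : IntegrableOn (fun t : ℝ => M * t ^ (s.re - 1)) (Ioc 0 u₀) volume := by
    have := (intervalIntegral.intervalIntegrable_rpow' (a := 0) (b := u₀)
      (by linarith : -1 < s.re - 1)).1
    exact this.const_mul M
  calc ‖∫ t : ℝ in Ioc 0 u₀, (t : ℂ) ^ (s - 1) • S t‖
      ≤ ∫ t : ℝ in Ioc 0 u₀, M * t ^ (s.re - 1) := norm_integral_le_of_norm_le hint hbound
    _ = M * (u₀ ^ s.re / s.re) := by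
        rw [integral_const_mul, ← intervalIntegral.integral_of_le hu₀.le,
          integral_rpow (Or.inl (by linarith : -1 < s.re - 1))]
        congr 1
        rw [sub_add_cancel, Real.zero_rpow hs.ne', sub_zero]
    _ = M * u₀ ^ s.re / s.re := by ring

/-- THE WINDOW TRANSFORM AT A ZETA ZERO IS AS SMALL AS THE LEAK: combining
`mellin_window_eq_neg_leak_of_riemannZeta_eq_zero` with `norm_mellin_indicator_Ioc_le`, if the E-map sum
is bounded by `M` on `(0, u₀]` then at every zeta zero `ρ` with `0 < Re ρ`, `ρ ≠ 1`,
`‖mellin (window part) ρ‖ ≤ M u₀^{Re ρ} / Re ρ`. (The remaining analytic input of the programme's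
step (★) is the Poisson bound making `M` superpolynomially small in `λ`.) -/
theorem norm_mellin_window_le_of_riemannZeta_eq_zero (h : SchwartzMap ℝ ℂ) {lam u₀ u₁ C M : ℝ}
    (hlam : 0 < lam) (hu₀ : 0 < u₀)
    (hSm : AEStronglyMeasurable (fun u : ℝ => ∑' n : ℕ, h (((n + 1 : ℕ) : ℝ) * (lam⁻¹ * u))) volume)
    (hSb : ∀ u : ℝ, 0 < u → ‖∑' n : ℕ, h (((n + 1 : ℕ) : ℝ) * (lam⁻¹ * u))‖ ≤ C)
    (hS0 : ∀ u : ℝ, u₁ ≤ u → (∑' n : ℕ, h (((n + 1 : ℕ) : ℝ) * (lam⁻¹ * u))) = 0)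
    (hM : ∀ u : ℝ, 0 < u → u ≤ u₀ → ‖∑' n : ℕ, h (((n + 1 : ℕ) : ℝ) * (lam⁻¹ * u))‖ ≤ M)
    {ρ : ℂ} (hρ : 0 < ρ.re) (hρ1 : ρ ≠ 1) (hζ : riemannZeta ρ = 0) :
    ‖mellin ((Ioi u₀).indicator fun u : ℝ => ∑' n : ℕ, h (((n + 1 : ℕ) : ℝ) * (lam⁻¹ * u))) ρ‖
      ≤ M * u₀ ^ ρ.re / ρ.re := by
  rw [mellin_window_eq_neg_leak_of_riemannZeta_eq_zero h hlam hu₀ hSm hSb hS0 hρ hρ1 hζ, norm_neg]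
  exact norm_mellin_indicator_Ioc_le hu₀ hM hρ

end EMap

end Summit.RiemannHypothesis.RiemannHypothesis.Theorems
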